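import Summits.Ventures.YMGap.Conjectures.StrongCouplingChiralLROSchwingerDysonSmallBeta
import Summits.Ventures.YMGap.Conjectures.StrongCouplingChiralLROProof
import Literature.MathematicalPhysics.StatisticalMechanics.ComplexSpinSchwingerDysonSharp
import HarnessLib
import HarnessLib.Audit.Tags

/-!
# Chiral long-range order at small `β > 0` for the `U(N)` theory with one staggered fermion, EVERY `N ≥ 1`:
# the typed conjecture `SalmhoferSeilerSmallBeta` (Y3) without the restriction `N ≤ 4`

Cell `pub-ymgap`, seat qcd-lit g24 (literature-prover), `bears_on: Q1`.  Everything is a theorem (0 facts,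
0 sorry).  Sequel of `…SchwingerDysonSmallBeta` (row S4 at small `β`, `1 ≤ N ≤ 4`, constant `(2N)²/K(N)`)
and of `…ChiralLROProof` (`salmhoferSeilerSmallBeta_holds`, `1 ≤ N ≤ 4`).

THE POINT.  In Salmhofer–Seiler's proof the restriction `N ≤ 4` (Cor. 4.9) comes ONLY from the
Schwinger–Dyson constant `K(N) = ∑_k k w_k α_k` of Lemma 4.7/(4.39), which grows like `N²`.  The Literature
file `ComplexSpinSchwingerDysonSharp` replaces `K(N)` by `N` at `β = 0` (the `U(N)` bond data satisfy
`n a_n ≤ N² a_{n-1}`; in the dimer picture `∑_y n_{xy} = N`).  This file does the same at `β ≥ 0`, inside the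
g19 machinery (SD equation at fixed gauge field + chiral-swap positivity + one-link resampling):

* **`re_integral_kinAt_update_le_sharp`** — at EVERY configuration of the other links, after resampling the
  link `b`: `Re(s ∫dg ∫dψ̄dψ F·kin_{x,b}·e^{A(U[b←g])}) ≤ N² Re(s ∫dg ∫dψ̄dψ F·(σσ)_b·e^{A(U[b←g])})` for `F`
  in the chiral cone — because `∫dg` turns the kinetic insertion into `N_x B̃_b = ∑_k k a_k (σσ)_b^k` and the
  plain weight into `B̃_b = ∑_k a_k (σσ)_b^k` (tree: `integral_berezin_kinAt_update`, `chargeOp_bar_bondFactor`,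
  `integral_berezin_update`), every `s∫dψ̄dψ F (σσ)_b^n e^{A_{∖b}(U)}` is `≥ 0` (chiral-swap positivity at fixed
  gauge field, `chiralSign_mul_berezin_actionOn_nonneg`), and `n a_n ≤ N² a_{n-1}` (`uNBondCoeff_mul_le`).
  NO Taylor data `w` of `log B`, no sign condition, no Lemma 4.7 — hence no restriction on `N`.
* `re_bondIntegral_le_sharp`, `sd_base_sharp` — the bond and site inequalities of `…Estimates` with
  `N ∑_i i w_i S_β(F(σσ)^i)` replaced by `N² S_β(F(σσ))`;
* `sdBoundSharp N ν β = (2N)² (N - 2νκ(β))/(N² e^{βc} + κ(β))` (`→ 4N` as `β → 0`), **`schwingerDyson_bound_sharp`**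
  (every `N ≥ 1`, every `β ≥ 0`, every even `L`), **`schwingerDysonBound_smallBeta_sharp`** ((SD)_{β,4N-ε});
* **`chiralLRO_allN`** — for EVERY `N ≥ 1` and `ν ≥ 4`: `∃ β₀ > 0, c > 0, L₀` with `ssChiralOrder N ν L β ≥ c`
  for all `0 ≤ β < β₀` and all even `L ≥ L₀` (margin: `2·4N·S(ν) < 4N` iff `S(ν) < ½`; certified `S(ν) < 0.35`);
  **`salmhoferSeilerSmallBeta_allColours`** — the body of Y3 with `N ≤ 4` deleted.

Honest framing: lattice `U(N)` gauge theory with ONE massless staggered fermion on finite even tori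
`(ℤ/Lℤ)^ν`, `ν ≥ 4`, `0 ≤ β < β₀(N, ν)`; long-range order in the Cesàro form of Y3.  The `β > 0` statement is
NOT IN PRINT (Salmhofer–Seiler: `β = 0`, `N ≤ 4`; §5 p. 424 states the small-`β` extension as an expectation).
Nothing about `SU(N)`, several flavours, the condensate at `m → 0⁺`, the continuum, or the summit's `QCD`
conjunct.

## References
* [SalmhoferSeiler1991] M. Salmhofer, E. Seiler, Commun. Math. Phys. 139 (1991) 395–432: (2.23), (3.44)–(3.46),
  Lemma 4.7, Thm. 4.8 (4.38)–(4.42), Cor. 4.9, §5 p. 424.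
* [MontvayMunster1994] I. Montvay, G. Münster, *Quantum Fields on a Lattice*, §5.1.6 (5.120)–(5.121).
* [SeilerLNP1982] E. Seiler, LNP 159, Ch. 2 (the plaquette-weight oscillation).
-/

noncomputable section

open MeasureTheory Finset
open scoped ComplexConjugate Matrix BigOperators
open Literature.MathematicalPhysics.QuantumFieldTheory (Site Edge GaugeConfig wilsonAction wilsonWeight wilsonMeasure
  partitionFunction haarProbability)
open Literature.MathematicalPhysics.QuantumLattice
open Literature.MathematicalPhysics.QuantumLattice.GrassmannAlgebra
open Literature.MathematicalPhysics.QuantumLattice.StrongCoupling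
open Literature.MathematicalPhysics.QuantumLattice.StaggeredRP (expect definingRep eoParity_torusLinks)
open Literature.MathematicalPhysics.QuantumLattice.StaggeredDeterminant (eoParity)
open Literature.MathematicalPhysics.StatisticalMechanics
open Literature.Probability.LatticeModels (TorusSite)

namespace Summit.Ventures.YMGap.Conjectures

namespace SchwingerDyson

variable {N ν L : ℕ} [NeZero L]

variable [LinearOrder (TorusSite ν L)]

/-! ### The sharp one-link comparison at fixed gauge field -/

/-- Linearity of `G ↦ Re(s∫dψ̄dψ F·G·W)` over real combinations of powers. [cite: MontvayMunster1994, §5.1.6 (5.120)–(5.121)] -/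
theorem re_chiralSign_mul_berezin_sum_smul (F W : FermiAlg (TorusSite ν L) N) (G : ℕ → FermiAlg (TorusSite ν L) N)
    (r : ℕ → ℝ) (s : Finset ℕ) :
    (chiralSign (N := N) (evens ν L) * berezin ℂ _ (F * (∑ k ∈ s, ((r k : ℝ) : ℂ) • G k) * W)).re =
      ∑ k ∈ s, r k * (chiralSign (N := N) (evens ν L) * berezin ℂ _ (F * G k * W)).re := by
  rw [Finset.mul_sum, Finset.sum_mul, map_sum, Finset.mul_sum, Complex.re_sum]
  refine Finset.sum_congr rfl fun k _ => ?_
  rw [mul_smul_comm, smul_mul_assoc, map_smul, smul_eq_mul, mul_left_comm, Complex.re_ofReal_mul]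

/-- **The sharp one-link comparison, at EVERY configuration of the other links.**  For `x` even, a bond
`b ∋ x`, `F` in the chiral cone and every `U`:
`Re(s ∫dg ∫dψ̄dψ F·kin_{x,b}(U[b←g])·e^{A(U[b←g])}) ≤ N² · Re(s ∫dg ∫dψ̄dψ F·(σσ)_b·e^{A(U[b←g])})` —
the Haar integral over `g` turns the left side into `∑_k k a_k · s∫ F(σσ)_b^k e^{A_{∖b}}` and the right side
into `N² ∑_k a_k · s∫ F(σσ)_b^{k+1} e^{A_{∖b}}`, all `s∫ … ≥ 0`, and `n a_n ≤ N² a_{n-1}`. [cite: SalmhoferSeiler1991, (3.44)–(3.46) with (2.16)–(2.23)] -/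
theorem re_integral_kinAt_update_le_sharp (hL : Even L) (hN : N ≠ 0) {x : TorusSite ν L}
    {e : Edge ν L} (hxe : (torusLinks ν L e).1 = x ∨ (torusLinks ν L e).2 = x)
    {F : FermiAlg (TorusSite ν L) N} (hF : IsChiralPositive (evens ν L) F) (U : GaugeConfig ν L (UN N)) :
    (chiralSign (N := N) (evens ν L) * ∫ g, berezin ℂ _ (F * kinAt x (torusLinks ν L) (stagSigns ν L) (Function.update U e g) e *
        fermiW (Function.update U e g)) ∂(haarProbability (UN N))).re ≤
      (N : ℝ) ^ 2 * (chiralSign (N := N) (evens ν L) * ∫ g, berezin ℂ _ (F * spinPair (torusLinks ν L e).1 (torusLinks ν L e).2 *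
        fermiW (Function.update U e g)) ∂(haarProbability (UN N))).re := by
  have hle : (torusLinks ν L e).1 ≠ (torusLinks ν L e).2 := torusLinks_ne (StaggeredRP.one_lt_of_even_neZero hL) e
  have hz : x = (torusLinks ν L e).1 ∨ x = (torusLinks ν L e).2 := hxe.elim (fun h => Or.inl h.symm) fun h => Or.inr h.symm
  set T : FermiAlg (TorusSite ν L) N := spinPair (torusLinks ν L e).1 (torusLinks ν L e).2 with hT
  set W : FermiAlg (TorusSite ν L) N :=
    grassmannExp (actionOn (Finset.univ.erase e) (torusLinks ν L) (stagSigns ν L) U) with hW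
  have h1 := integral_berezin_kinAt_update x (Finset.mem_univ e) (torusLinks ν L) hle (Γ := stagSigns ν L) (stagSigns_sq e) U F
  have h2 := integral_berezin_update (Finset.mem_univ e) (torusLinks ν L) hle (Γ := stagSigns ν L) (stagSigns_sq e) U (F * T)
  simp only [fermiW]
  rw [h1, h2, ← hW, chargeOp_bar_bondFactor hN hle hz, bondFactor_eq_sum_spinPair_pow hN, ← hT]
  -- the nonnegative moments `p_k = Re(s∫ F T^k W)`
  set p : ℕ → ℝ := fun k => (chiralSign (N := N) (evens ν L) * berezin ℂ _ (F * T ^ k * W)).re with hp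
  have hp0 : ∀ k, 0 ≤ p k := fun k =>
    (chiralSign_mul_berezin_actionOn_nonneg (Finset.univ.erase e) (torusLinks ν L) (fst_mem_evens_iff hL) conj_stagSigns U
      (hF.mul (isChiralPositive_spinPair_pow (torusLinks ν L e).1 (torusLinks ν L e).2 k))).1
  -- left side `= ∑_k k a_k p_k`
  have hcoef : ∀ k : ℕ, ((k : ℂ) * (ComplexSpin.uNBondCoeff N k : ℂ)) = (((k : ℝ) * ComplexSpin.uNBondCoeff N k : ℝ) : ℂ) := by
    intro k; push_cast; ring
  simp_rw [hcoef]
  rw [re_chiralSign_mul_berezin_sum_smul F W (fun k => T ^ k)]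
  -- right side `= N² ∑_k a_k p_{k+1}`
  have hTB : F * T * (∑ k ∈ Finset.range (N + 1), ((ComplexSpin.uNBondCoeff N k : ℝ) : ℂ) • T ^ k) * W =
      F * (∑ k ∈ Finset.range (N + 1), ((ComplexSpin.uNBondCoeff N k : ℝ) : ℂ) • (T ^ k * T)) * W := by
    rw [Finset.mul_sum, Finset.mul_sum]
    congr 1
    refine Finset.sum_congr rfl fun k _ => ?_
    rw [mul_smul_comm, mul_smul_comm, mul_assoc, ← pow_succ', ← pow_succ]
  have hTB' : (∑ k ∈ Finset.range (N + 1), ((ComplexSpin.uNBondCoeff N k : ℝ) : ℂ) • (T ^ k * T)) =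
      ∑ k ∈ Finset.range (N + 1), ((ComplexSpin.uNBondCoeff N k : ℝ) : ℂ) • T ^ (k + 1) := by
    refine Finset.sum_congr rfl fun k _ => ?_
    rw [pow_succ]
  rw [hTB, hTB', re_chiralSign_mul_berezin_sum_smul F W (fun k => T ^ (k + 1))]
  -- compare termwise after dropping `k = 0` on the left and `k = N` on the right
  rw [Finset.sum_range_succ' (fun k => (k : ℝ) * ComplexSpin.uNBondCoeff N k * p k) N,
    Finset.sum_range_succ (fun k => ComplexSpin.uNBondCoeff N k * p (k + 1)) N, mul_add, Finset.mul_sum]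
  simp only [Nat.cast_zero, zero_mul, add_zero]
  have hlast : 0 ≤ (N : ℝ) ^ 2 * (ComplexSpin.uNBondCoeff N N * p (N + 1)) :=
    mul_nonneg (sq_nonneg _) (mul_nonneg (ComplexSpin.uNBondCoeff_nonneg N N) (hp0 _))
  have hsum : ∑ k ∈ Finset.range N, ((k + 1 : ℕ) : ℝ) * ComplexSpin.uNBondCoeff N (k + 1) * p (k + 1) ≤
      ∑ k ∈ Finset.range N, (N : ℝ) ^ 2 * (ComplexSpin.uNBondCoeff N k * p (k + 1)) := by
    refine Finset.sum_le_sum fun k hk => ?_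
    have hk' : k < N := Finset.mem_range.mp hk
    have h := ComplexSpin.uNBondCoeff_mul_le (N := N) (n := k + 1) (by omega) (by omega)
    rw [Nat.add_sub_cancel] at h
    calc ((k + 1 : ℕ) : ℝ) * ComplexSpin.uNBondCoeff N (k + 1) * p (k + 1)
        ≤ (N : ℝ) ^ 2 * ComplexSpin.uNBondCoeff N k * p (k + 1) := mul_le_mul_of_nonneg_right h (hp0 _)
      _ = (N : ℝ) ^ 2 * (ComplexSpin.uNBondCoeff N k * p (k + 1)) := by ring
  linarith [hsum, hlast]

/-! ### The sharp main-term and bond-term bounds with the plaquette weight -/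

/-- **Sharp main term**: integrating the one-link comparison against the frozen plaquette weight
`e^{-βS_W(U[b←1])} ≥ 0`: `Re(s·main(F, kin_b)) ≤ N²·Re(s·main(F(σσ)_b))`. [cite: SalmhoferSeiler1991, (3.44)–(3.46) and (4.31)] -/
theorem re_mainTerm_kinAt_le_sharp (hL : Even L) (hN : N ≠ 0) (β : ℝ) {x : TorusSite ν L}
    {e : Edge ν L} (hxe : (torusLinks ν L e).1 = x ∨ (torusLinks ν L e).2 = x)
    {F : FermiAlg (TorusSite ν L) N} (hF : IsChiralPositive (evens ν L) F) :
    (chiralSign (N := N) (evens ν L) * ∫ p, (plaq N ν L β (Function.update p.1 e 1) : ℂ) *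
        berezin ℂ _ (F * kinAt x (torusLinks ν L) (stagSigns ν L) (Function.update p.1 e p.2) e * fermiW (Function.update p.1 e p.2))
        ∂((haarPi N ν L).prod (haarProbability (UN N)))).re ≤
      (N : ℝ) ^ 2 * (chiralSign (N := N) (evens ν L) * ∫ p, (plaq N ν L β (Function.update p.1 e 1) : ℂ) *
        berezin ℂ _ (F * spinPair (torusLinks ν L e).1 (torusLinks ν L e).2 * fermiW (Function.update p.1 e p.2))
        ∂((haarPi N ν L).prod (haarProbability (UN N)))).re := by
  set T : FermiAlg (TorusSite ν L) N := spinPair (torusLinks ν L e).1 (torusLinks ν L e).2 with hT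
  have hA : Integrable (fun p : GaugeConfig ν L (UN N) × UN N => (plaq N ν L β (Function.update p.1 e 1) : ℂ) *
      berezin ℂ _ (F * kinAt x (torusLinks ν L) (stagSigns ν L) (Function.update p.1 e p.2) e * fermiW (Function.update p.1 e p.2)))
      ((haarPi N ν L).prod (haarProbability (UN N))) :=
    integrable_of_continuous_prod ((Complex.continuous_ofReal.comp (continuous_plaq_upd_one β e)).mul (continuous_berezin_kin_upd hL x e F))
  have hB : Integrable (fun p : GaugeConfig ν L (UN N) × UN N => (plaq N ν L β (Function.update p.1 e 1) : ℂ) *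
      berezin ℂ _ (F * T * fermiW (Function.update p.1 e p.2)))
      ((haarPi N ν L).prod (haarProbability (UN N))) :=
    integrable_of_continuous_prod ((Complex.continuous_ofReal.comp (continuous_plaq_upd_one β e)).mul (continuous_berezin_upd hL e _))
  -- iterate the integrals
  rw [integral_prod _ hA, integral_prod _ hB, ← integral_const_mul, ← integral_const_mul]
  have hIA := hA.integral_prod_left.const_mul (chiralSign (N := N) (evens ν L))
  have hIB := hB.integral_prod_left.const_mul (chiralSign (N := N) (evens ν L))
  rw [← RCLike.re_eq_complex_re, ← integral_re hIA, ← integral_re hIB, ← integral_const_mul]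
  refine integral_mono hIA.re (hIB.re.const_mul _) fun U => ?_
  dsimp only
  rw [integral_const_mul, integral_const_mul, RCLike.re_eq_complex_re,
    mul_left_comm (chiralSign (N := N) (evens ν L)), Complex.re_ofReal_mul,
    mul_left_comm (chiralSign (N := N) (evens ν L)), Complex.re_ofReal_mul]
  have hkey := re_integral_kinAt_update_le_sharp hL hN hxe hF U
  rw [← hT] at hkey
  have hp : 0 ≤ plaq N ν L β (Function.update U e 1) := (plaq_pos β _).le
  calc plaq N ν L β (Function.update U e 1) * _ ≤ plaq N ν L β (Function.update U e 1) * ((N : ℝ) ^ 2 * _) :=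
        mul_le_mul_of_nonneg_left hkey hp
    _ = _ := by ring

/-- **Sharp upper bound for one bond term of the Schwinger–Dyson equation at `β ≥ 0`**:
`Re(s I_b(F)) ≤ N² e^{βc} S_β(F(σσ)_b) + κ(β)(S_β(F(σσ)_b) + S_β(F))` — `re_bondIntegral_le` with
`N ∑_i i w_i S_β(F(σσ)_b^i)` replaced by `N² S_β(F(σσ)_b)`; every `N ≥ 1`, no `w`. [cite: SalmhoferSeiler1991, (4.31)–(4.34) and (4.38)] -/
theorem re_bondIntegral_le_sharp (hL : Even L) (hN : N ≠ 0) {β : ℝ} (hβ : 0 ≤ β) {x : TorusSite ν L} (hx : x ∈ evens ν L)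
    {e : Edge ν L} (hxe : (torusLinks ν L e).1 = x ∨ (torusLinks ν L e).2 = x) {F : FermiAlg (TorusSite ν L) N}
    (hF : IsChiralPositive (evens ν L) F) :
    (chiralSign (N := N) (evens ν L) *
        ∫ U, (plaq N ν L β U : ℂ) * berezin ℂ _ (F * kinAt x (torusLinks ν L) (stagSigns ν L) U e * fermiW U) ∂(haarPi N ν L)).re ≤
      (N : ℝ) ^ 2 * Real.exp (β * linkOsc ν N) * sdS N ν L β (F * spinPair (torusLinks ν L e).1 (torusLinks ν L e).2) +
        kap N ν β * (sdS N ν L β (F * spinPair (torusLinks ν L e).1 (torusLinks ν L e).2) + sdS N ν L β F) := by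
  set T : FermiAlg (TorusSite ν L) N := spinPair (torusLinks ν L e).1 (torusLinks ν L e).2 with hT
  have hA1 : Integrable (fun p : GaugeConfig ν L (UN N) × UN N => (plaq N ν L β (Function.update p.1 e 1) : ℂ) *
      berezin ℂ _ (F * kinAt x (torusLinks ν L) (stagSigns ν L) (Function.update p.1 e p.2) e * fermiW (Function.update p.1 e p.2)))
      ((haarPi N ν L).prod (haarProbability (UN N))) :=
    integrable_of_continuous_prod ((Complex.continuous_ofReal.comp (continuous_plaq_upd_one β e)).mul (continuous_berezin_kin_upd hL x e F))
  have hA : Integrable (fun p : GaugeConfig ν L (UN N) × UN N => (plaq N ν L β (Function.update p.1 e p.2) : ℂ) *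
      berezin ℂ _ (F * kinAt x (torusLinks ν L) (stagSigns ν L) (Function.update p.1 e p.2) e * fermiW (Function.update p.1 e p.2)))
      ((haarPi N ν L).prod (haarProbability (UN N))) :=
    integrable_of_continuous_prod ((Complex.continuous_ofReal.comp (continuous_plaq_upd β e)).mul (continuous_berezin_kin_upd hL x e F))
  have hsplit : ∫ U, (plaq N ν L β U : ℂ) * berezin ℂ _ (F * kinAt x (torusLinks ν L) (stagSigns ν L) U e * fermiW U) ∂(haarPi N ν L) =
      (∫ p, (plaq N ν L β (Function.update p.1 e 1) : ℂ) *
          berezin ℂ _ (F * kinAt x (torusLinks ν L) (stagSigns ν L) (Function.update p.1 e p.2) e * fermiW (Function.update p.1 e p.2))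
          ∂((haarPi N ν L).prod (haarProbability (UN N)))) +
        ∫ p, ((plaq N ν L β (Function.update p.1 e p.2) : ℂ) - plaq N ν L β (Function.update p.1 e 1)) *
          berezin ℂ _ (F * kinAt x (torusLinks ν L) (stagSigns ν L) (Function.update p.1 e p.2) e * fermiW (Function.update p.1 e p.2))
          ∂((haarPi N ν L).prod (haarProbability (UN N))) := by
    rw [kinJ_eq_integral_prod hL β x e F, ← integral_add hA1 ((hA.sub hA1).congr (ae_of_all _ fun p => by
      simp only [Pi.sub_apply]; ring))]
    exact integral_congr_ae (ae_of_all _ fun p => by ring)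
  rw [hsplit, mul_add (chiralSign (N := N) (evens ν L)), Complex.add_re]
  have hmain := re_mainTerm_kinAt_le_sharp hL hN β hxe hF
  have hb := (mainTerm_bounds hL hβ e (hF.mul (isChiralPositive_spinPair_pow (torusLinks ν L e).1 (torusLinks ν L e).2 1))).2
  rw [pow_one, ← hT] at hb
  rw [← hT] at hmain
  have hmain' : (chiralSign (N := N) (evens ν L) * ∫ p, (plaq N ν L β (Function.update p.1 e 1) : ℂ) *
        berezin ℂ _ (F * kinAt x (torusLinks ν L) (stagSigns ν L) (Function.update p.1 e p.2) e * fermiW (Function.update p.1 e p.2))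
        ∂((haarPi N ν L).prod (haarProbability (UN N)))).re ≤
      (N : ℝ) ^ 2 * Real.exp (β * linkOsc ν N) * sdS N ν L β (F * T) := by
    refine hmain.trans ?_
    rw [mul_assoc]
    exact mul_le_mul_of_nonneg_left hb (sq_nonneg _)
  have hrem := norm_remainder_le hL hN hβ hx hxe hF
  rw [← hT] at hrem
  have hre2 := (Complex.abs_re_le_norm (chiralSign (N := N) (evens ν L) *
    ∫ p, ((plaq N ν L β (Function.update p.1 e p.2) : ℂ) - plaq N ν L β (Function.update p.1 e 1)) *
      berezin ℂ _ (F * kinAt x (torusLinks ν L) (stagSigns ν L) (Function.update p.1 e p.2) e * fermiW (Function.update p.1 e p.2))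
      ∂((haarPi N ν L).prod (haarProbability (UN N))))).trans
    (by rw [norm_mul, norm_chiralSign, one_mul])
  have hre' := (abs_le.mp (hre2.trans hrem)).2
  linarith

/-- **(4.38) at `β ≥ 0` with the dimer constant, UNIFORMLY IN THE VOLUME**: for every `N ≥ 1`, `x` even,
`β ≥ 0`: `(N - 2νκ(β)) S_β(1) ≤ (N² e^{βc} + κ(β)) ∑_{b ∋ x} S_β((σσ)_b)`.  At `β = 0`:
`1 ≤ N ∑_{|y-x|=1}⟨σ_xσ_y⟩` (the Literature file's `uN_partitionFunction_le_sharp`). [cite: SalmhoferSeiler1991, Thm. 4.8 (4.38)] -/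
theorem sd_base_sharp (hL : Even L) (hN : 1 ≤ N) {β : ℝ} (hβ : 0 ≤ β) {x : TorusSite ν L} (hx : x ∈ evens ν L) :
    ((N : ℝ) - 2 * ν * kap N ν β) * sdS N ν L β 1 ≤
      ((N : ℝ) ^ 2 * Real.exp (β * linkOsc ν N) + kap N ν β) *
        ∑ e ∈ bondsAt ν L x, sdS N ν L β (spinPair (torusLinks ν L e).1 (torusLinks ν L e).2) := by
  have hN0 : N ≠ 0 := by omega
  have hSD := sdS_schwingerDyson (N := N) hL β x (F := 1) (n := 0) (by rw [chargeOp_one, Complex.ofReal_zero, zero_smul])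
  have hκ0 : 0 ≤ kap N ν β := kap_nonneg hβ
  have hS1 : 0 ≤ sdS N ν L β 1 := sdS_nonneg hL β IsChiralPositive.one
  have hbond : ∀ e ∈ bondsAt ν L x,
      (chiralSign (N := N) (evens ν L) * ∫ U, (plaq N ν L β U : ℂ) *
          berezin ℂ _ (1 * kinAt x (torusLinks ν L) (stagSigns ν L) U e * fermiW U) ∂(haarPi N ν L)).re ≤
        ((N : ℝ) ^ 2 * Real.exp (β * linkOsc ν N) + kap N ν β) * sdS N ν L β (spinPair (torusLinks ν L e).1 (torusLinks ν L e).2) +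
          kap N ν β * sdS N ν L β 1 := by
    intro e he
    have h := re_bondIntegral_le_sharp hL hN0 hβ hx (mem_bondsAt.mp he) IsChiralPositive.one
    simp only [one_mul] at h ⊢
    nlinarith [h]
  have hsum := Finset.sum_le_sum hbond
  rw [← hSD, Finset.sum_add_distrib, Finset.sum_const, nsmul_eq_mul, ← Finset.mul_sum] at hsum
  have hcard : ((bondsAt ν L x).card : ℝ) ≤ 2 * ν := by
    have h3 := card_bondsAt_le (ν := ν) (L := L) x
    have h4 : (((bondsAt ν L x).card : ℕ) : ℝ) ≤ (ν : ℝ) + ν := by exact_mod_cast h3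
    linarith
  have h1 : ((bondsAt ν L x).card : ℝ) * (kap N ν β * sdS N ν L β 1) ≤ 2 * ν * (kap N ν β * sdS N ν L β 1) :=
    mul_le_mul_of_nonneg_right hcard (mul_nonneg hκ0 hS1)
  rw [sub_zero] at hsum
  linarith

/-! ### The explicit constant and the volume-uniform Schwinger–Dyson bound for every `N` -/

variable (N ν) in
/-- **The sharp volume-independent Schwinger–Dyson constant `b♯(β) = (2N)² (N - 2νκ(β))/(N² e^{βc} + κ(β))`**,
`b♯(0) = (2N)²/N = 4N`. [cite: SalmhoferSeiler1991, Thm. 4.8 (4.38)] -/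
def sdBoundSharp (β : ℝ) : ℝ :=
  (2 * N : ℝ) ^ 2 * (((N : ℝ) - 2 * ν * kap N ν β) / ((N : ℝ) ^ 2 * Real.exp (β * linkOsc ν N) + kap N ν β))

/-- **THE SCHWINGER–DYSON LOWER BOUND AT `β ≥ 0` WITH THE DIMER CONSTANT, EVERY `N ≥ 1`, UNIFORMLY IN THE
VOLUME**: `∑_μ (T_β(e_μ) + T_β(-e_μ)) ≥ b♯(β)` for every `β ≥ 0` and every even `L`,
`T_β = ssTwoPoint N ν L β 0 0`. [cite: SalmhoferSeiler1991, Thm. 4.8 (4.38)–(4.39)] -/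
theorem schwingerDyson_bound_sharp (hN : 1 ≤ N) (hν : 1 ≤ ν) (hL : Even L) {β : ℝ} (hβ : 0 ≤ β) :
    sdBoundSharp N ν β ≤ ∑ μ : Fin ν, (ssTwoPoint N ν L β 0 0 (Pi.single μ 1) + ssTwoPoint N ν L β 0 0 (-Pi.single μ 1)) := by
  haveI : NeZero ν := ⟨by omega⟩
  have hN0 : N ≠ 0 := by omega
  have hL1 : 1 < L := StaggeredRP.one_lt_of_even_neZero hL
  have hS1 := sdS_one_pos (N := N) (ν := ν) (L := L) hL β
  have hsite := sd_base_sharp hL hN hβ (zero_mem_evens (ν := ν) (L := L))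
  rw [sum_bondsAt hL1] at hsite
  simp only [torusLinks, zero_add, zero_sub, neg_add_cancel] at hsite
  have hterm : ∀ μ : Fin ν, ssTwoPoint N ν L β 0 0 (Pi.single μ 1) + ssTwoPoint N ν L β 0 0 (-Pi.single μ 1) =
      (2 * N : ℝ) ^ 2 * ((sdS N ν L β (spinPair 0 (Pi.single μ 1)) +
        sdS N ν L β (spinPair (-Pi.single μ 1 : TorusSite ν L) 0)) / sdS N ν L β 1) := by
    intro μ
    rw [ssTwoPoint_eq_spinPair hN0 hL, ssTwoPoint_eq_spinPair hN0 hL, spinPair_comm (0 : TorusSite ν L) (-Pi.single μ 1)]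
    ring
  simp_rw [hterm]
  rw [← Finset.mul_sum, ← Finset.sum_div, sdBoundSharp]
  refine mul_le_mul_of_nonneg_left ?_ (by positivity)
  have hκ := kap_nonneg (N := N) (ν := ν) hβ
  have hDpos : 0 < (N : ℝ) ^ 2 * Real.exp (β * linkOsc ν N) + kap N ν β := by positivity
  rw [div_le_div_iff₀ hDpos hS1]
  linarith [hsite]

omit [NeZero L] [LinearOrder (TorusSite ν L)] in
/-- **`b♯(β) → 4N` as `β → 0`.** [cite: SalmhoferSeiler1991, Thm. 4.8 (4.38)–(4.39)] -/
theorem tendsto_sdBoundSharp (hN : 1 ≤ N) :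
    Filter.Tendsto (sdBoundSharp N ν) (nhds 0) (nhds (4 * N : ℝ)) := by
  have hN0 : (N : ℝ) ≠ 0 := by exact_mod_cast (show N ≠ 0 by omega)
  have h0 : sdBoundSharp N ν 0 = 4 * N := by
    rw [sdBoundSharp, kap_zero]
    simp only [mul_zero, sub_zero, zero_mul, Real.exp_zero, mul_one, add_zero]
    field_simp
    ring
  rw [← h0]
  have hk := continuous_kap (N := N) (ν := ν)
  have hc : ContinuousAt (sdBoundSharp N ν) 0 := by
    unfold sdBoundSharp
    refine ContinuousAt.mul continuousAt_const (ContinuousAt.div (by fun_prop) (by fun_prop) ?_)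
    rw [kap_zero]; simp [hN0]
  exact hc.tendsto

/-- **ROW S4 WITH THE DIMER CONSTANT AT SMALL `β > 0`, EVERY `N ≥ 1`, UNIFORMLY IN THE VOLUME**: for every
`ε > 0` there is `β₁ > 0` (depending on `N, ν, ε` only) such that (SD)_{β, 4N-ε} holds for all `0 ≤ β < β₁`
and ALL even `L`: `4N - ε ≤ ∑_μ (T_β(e_μ) + T_β(-e_μ))`. [cite: SalmhoferSeiler1991, Thm. 4.8 (4.38)] -/
theorem schwingerDysonBound_smallBeta_sharp (hN : 1 ≤ N) (hν : 1 ≤ ν) {ε : ℝ} (hε : 0 < ε) :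
    ∃ β₁ : ℝ, 0 < β₁ ∧ ∀ β : ℝ, 0 ≤ β → β < β₁ → ∀ (L : ℕ) [NeZero L], Even L →
      4 * (N : ℝ) - ε ≤
        ∑ μ : Fin ν, (ssTwoPoint N ν L β 0 0 (Pi.single μ 1) + ssTwoPoint N ν L β 0 0 (-Pi.single μ 1)) := by
  obtain ⟨δ₁, hδ₁, h₁⟩ := Metric.tendsto_nhds_nhds.mp (tendsto_sdBoundSharp (ν := ν) hN) ε hε
  refine ⟨δ₁, hδ₁, fun β hβ hβ1 L _ hL => ?_⟩
  letI : LinearOrder (TorusSite ν L) :=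
    LinearOrder.lift' (Fintype.equivFin (TorusSite ν L)) (Fintype.equivFin (TorusSite ν L)).injective
  have hd1 : dist β 0 < δ₁ := by rw [dist_zero_right, Real.norm_eq_abs, abs_of_nonneg hβ]; exact hβ1
  have hb := h₁ hd1
  rw [Real.dist_eq] at hb
  have hmain := schwingerDyson_bound_sharp (L := L) hN hν hL hβ
  have := (abs_lt.mp hb).1
  linarith

end SchwingerDyson

/-! ### Chiral long-range order at small `β > 0` for every `N` -/

namespace MesonWeight

variable {N ν : ℕ}

/-- **CHIRAL LONG-RANGE ORDER FOR THE `U(N)` THEORY WITH ONE STAGGERED FERMION, EVERY `N ≥ 1`, EVERY `ν ≥ 4`,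
AT SMALL `β > 0`, UNIFORMLY IN THE VOLUME**: there are `β₀ > 0`, `c > 0`, `L₀` with `ssChiralOrder N ν L β ≥ c`
for all `0 ≤ β < β₀` and all even `L ≥ L₀`.  Inputs: the infrared bound (IR)_{β,4N} at every `β` (`infraredBound`,
all-colour certificate), the sharp Schwinger–Dyson bound (SD)_{β,4N-ε} (`schwingerDysonBound_smallBeta_sharp`),
the margin `2·4N·S(ν) < 4N` (`S(ν) < 0.35 < ½`, `fluctS_lt_of_four_le`) and `kernel_chiralLRO_uniform`.
[cite: SalmhoferSeiler1991, Thm. 4.8 and Cor. 4.9 with (4.41)–(4.42), Remark 4.5, §5 p. 424] -/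
theorem chiralLRO_allN (hN : 1 ≤ N) (hν : 4 ≤ ν) :
    ∃ β₀ : ℝ, 0 < β₀ ∧ ∃ c : ℝ, 0 < c ∧ ∃ L₀ : ℕ, ∀ β : ℝ, 0 ≤ β → β < β₀ →
      ∀ (L : ℕ) [NeZero L], Even L → L₀ ≤ L → c ≤ ssChiralOrder N ν L β := by
  haveI : NeZero ν := ⟨by omega⟩
  have hν3 : 3 ≤ ν := by omega
  have hν1 : 1 ≤ ν := by omega
  have hN0 : N ≠ 0 := by omega
  have hNpos : (0 : ℝ) < N := by exact_mod_cast hN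
  have hS := ComplexSpin.fluctS_lt_of_four_le hν
  set ε : ℝ := (4 * (N : ℝ) - 2 * (4 * N : ℝ) * ComplexSpin.fluctS ν) / 2 with hε
  have hε0 : 0 < ε := by rw [hε]; nlinarith
  have hA : (0 : ℝ) ≤ 4 * N := by positivity
  have hAb : 2 * (4 * N : ℝ) * ComplexSpin.fluctS ν < 4 * N - ε := by rw [hε]; nlinarith
  obtain ⟨c, hc, L₁, hL₁⟩ := ComplexSpin.kernel_chiralLRO_uniform (ν := ν) hν3 hA hAb
  obtain ⟨β₁, hβ₁, hSD⟩ := SchwingerDyson.schwingerDysonBound_smallBeta_sharp (N := N) (ν := ν) hN hν1 hε0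
  refine ⟨β₁, hβ₁, c, hc, L₁, fun β hβ hββ₁ L _ hE hLe => ?_⟩
  have h := hL₁ L hE hLe (fun x y => ssTwoPoint N ν L β 0 x y)
    (fun x y a => ssTwoPoint_massless_add N ν L hE β x y a) (fun x y => ssTwoPoint_massless_comm N ν L β x y)
    (fun z hz => by
      refine ssTwoPoint_massless_eq_zero_of_sgn_eq N ν L hν1 hE.two_dvd β ?_
      rw [ComplexSpin.sgn_zero]
      unfold ComplexSpin.sgn
      rw [if_pos hz])
    (fun χ _ _ => infraredBound hN0 hE hβ χ)
    (hSD β hβ hββ₁ L hE)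
  unfold ssChiralOrder
  exact h

end MesonWeight

/-- **Y3 FOR EVERY NUMBER OF COLOURS**: the body of the typed conjecture `SalmhoferSeilerSmallBeta` with the
hypothesis `N ≤ 4` removed — for every `N ≥ 1` and `ν ≥ 4` there are `β₀ > 0`, `c > 0`, `L₀` with
`|Λ_L|⁻¹ ∑_x ⟨ψ̄ψ(0)ψ̄ψ(x)⟩_{Λ_L, β, m=0} ≥ c` for all `0 ≤ β < β₀` and all even `L ≥ L₀`.
[cite: SalmhoferSeiler1991, Thm. 4.8, Cor. 4.9, Remark 4.5 and §5 p. 424] -/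
theorem salmhoferSeilerSmallBeta_allColours (N ν : ℕ) (hN : 1 ≤ N) (hν : 4 ≤ ν) :
    ∃ β₀ : ℝ, 0 < β₀ ∧ ∃ c : ℝ, 0 < c ∧ ∃ L₀ : ℕ, ∀ β : ℝ, 0 ≤ β → β < β₀ →
      ∀ (L : ℕ) [NeZero L], Even L → L₀ ≤ L → c ≤ ssChiralOrder N ν L β :=
  MesonWeight.chiralLRO_allN hN hν

end Summit.Ventures.YMGap.Conjectures

end
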